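import Summits.CriticalPhenomena.PercolationContinuityZ3.Theorems.Transplant.SkelFrmBChoiceNums
import Summits.CriticalPhenomena.PercolationContinuityZ3.Theorems.Transplant.SkelFrmBParamsFaceBandA
import Summits.CriticalPhenomena.PercolationContinuityZ3.Theorems.Transplant.SkelFrmBParamsSlotsTA
import HarnessLib

/-!
# N2 (frames-only node `SamePDropOfSkeletonFrm₁`, OPEN) params column over `PlanarSkeletonFrm` — (F) value layer, **J19 / R0 SUCCESSOR of
# `SkelFrmBParamsFaceBandA`** (lead g12 2026-08-23T08:47:30Z: ONE kit radius in N2's (F) layer, the (S0) kit of record `KS0.R'0`/`KS0.Rlev0`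
# (SkelFrmBChoiceNums); the apron kit `KitA`/`KS.RA'` does not enter N2's (F) column; hp-8 g42's name table 08:54:57Z).

RULE (hp-8's registry rule): this successor module IMPORTS the original; radius-free declarations (`kFF₂_le_linA`, the first and third
conjuncts of `uA_oth_facts`) are USED from it, never re-declared; only the RA′-cone declarations are re-stated at `KS0.R'0` under the
successor names `uA_oth_factsR0`, `hkE_R0`. THE ONE NON-MECHANICAL STEP (device (d)): N1 read the cell floor `6·RA′ + 11 ≤ u_J` off the
box value `gT`'s own floors (`cells_geTA'`); at the kit radius `R'0` that floor is NOT a slot identity, so it travels as a NAMED HYPOTHESIS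
— here in the two interchangeable currencies the consumers use:
* the BOX FLOOR `hMR0 : 4·K·(R'0 + 2) ≤ M_L (gT mk gx)` (stmt-g21's residual `gxQ ⊇ 22000·Kq·(R'0+2)` dominates it since `4K = 160·Kq`,
  lemma `ML_floorR0_of_Kq` below), from which `cells_geR0A` / `uA_oth_factsR0` DERIVE the per-axis stride floors; or
* the STRIDE FLOOR itself `huR0 : 6·R'0 + 11 ≤ u_J` (`u_J = if oth I = 0 then u₀A else u₁A`; the shape of `TXAR0.hkE8_RAR0` p359097 and of
  hp-8's POSTED FLOORS (4) 09:33:53Z), taken by `hkE_R0`.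
Contents: §0 `ML_floorR0_of_Kq`, `cells_geR0A`, `uA_oth_factsR0` (the triple `r_J = 40·Kq·u_J`, `6·R'0 + 11 ≤ u_J`, `40·u_J ≤ r_J` from the
box floor); §1 `hkE_R0` (= `hkE_RA` at `Rl ≤ R'0`: `kFF₂ + 6u + 9 ≤ 5r_J` and `2·kFF₂ + 2u + 7 ≤ 5r_J`). Proofs are N1's `linarith` closings over
`kFF₂ ≤ 2r + 5Rl + 15` (p1's bound of record, radius-free) with the floor hypothesis in place of `cells_geTA'`.
builds on p205010 (kernel theorem, internal audit signed; external expert review pending) — nothing in this file uses p205010; NOTHING is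
claimed about the open node `SamePDropOfSkeletonFrm₁`; arithmetic only. The RA′ originals stay in the tree as valid, unused history.
Lane `prim-bschramm-*`, seat `prim-bschramm-p1` (gen 18); helper file (`--supports stmt-CriticalPhenomena-4575 --as helper`).
[cite: KozmaNitzan2024, §4 Lemma 12 (pp. 23–25)] [cite: MartineauTassion2017, §4.1]
-/

noncomputable section

open scoped Classical

namespace Summit.CriticalPhenomena.PercolationContinuityZ3.Theorems.Transplant

namespace PlanarSkeletonFrm

namespace NegB

open Literature.Probability.Percolation Literature.Probability.LatticeModels SimpleGraph
open Literature.Probability.Percolation.KozmaNitzan.Cells (oth)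
open SkelConc (Consts)
open Skelφ.StepI (DataN)
open Neg

/-! ## §0 The R′0 floors: box floor ⇒ cell floors ⇒ per-axis stride floor -/

section FloorsR0

/-- **stmt's Kq-currency dominates the box floor**: `22000·Kq·(R'0+2) ≤ M_L` gives `4·K·(R'0+2) ≤ M_L` (`K = 40·Kq`) and `22000·(R'0+2) ≤ M_L`. [folklore] -/
theorem ML_floorR0_of_Kq (κ : Consts) {V : Type} [DecidableEq V] [Countable V] {G : SimpleGraph V} [G.LocallyFinite] (Φ : PlanarSkeletonFrm G) (t : V) (p : unitInterval) (D : Skelφ.StepI.DataNS V) (g : ℕ) (mk : ℕ)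
    (hKq : 22000 * Neg.Kq κ * (KS0.R'0 κ Φ t p D mk + 2) ≤ ML κ Φ t p D g) :
    4 * Neg.K κ * (KS0.R'0 κ Φ t p D mk + 2) ≤ ML κ Φ t p D g ∧ 22000 * (KS0.R'0 κ Φ t p D mk + 2) ≤ ML κ Φ t p D g := by
  have hK : Neg.K κ = 40 * Neg.Kq κ := Neg.K_eq κ
  have h1 : 1 ≤ Neg.Kq κ := Neg.one_le_Kq κ
  constructor
  · calc 4 * Neg.K κ * (KS0.R'0 κ Φ t p D mk + 2) = 160 * Neg.Kq κ * (KS0.R'0 κ Φ t p D mk + 2) := by rw [hK]; ring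
      _ ≤ 22000 * Neg.Kq κ * (KS0.R'0 κ Φ t p D mk + 2) := by gcongr; norm_num
      _ ≤ ML κ Φ t p D g := hKq
  · calc 22000 * (KS0.R'0 κ Φ t p D mk + 2) = 22000 * 1 * (KS0.R'0 κ Φ t p D mk + 2) := by ring
      _ ≤ 22000 * Neg.Kq κ * (KS0.R'0 κ Φ t p D mk + 2) := by gcongr
      _ ≤ ML κ Φ t p D g := hKq

/-- **THE (ζ′) CELLS DOMINATE THE (S0) KIT RADIUS** under the box floor `4·K·(R'0+2) ≤ M_L` (any `g`, `f`): `6·R'0 + 11 ≤ s₀` and `14·R'0 + 27 ≤ s₁`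
(`KS.sA_ge_of_floor'`). [folklore] -/
theorem cells_geR0A (κ : Consts) {V : Type} [DecidableEq V] [Countable V] {G : SimpleGraph V} [G.LocallyFinite] (Φ : PlanarSkeletonFrm G) (t : V) (p : unitInterval) (D : Skelφ.StepI.DataNS V) (g : ℕ) (f : ℕ) (mk : ℕ) (hN : EqNumL κ Φ t p D g f) (hκ : (hL κ Φ t p D g f).natAbs ≤ 10 * nL κ Φ t p D g f)
    (hMR0 : 4 * Neg.K κ * (KS0.R'0 κ Φ t p D mk + 2) ≤ ML κ Φ t p D g) :
    6 * (KS0.R'0 κ Φ t p D mk : ℤ) + 11 ≤ (((fcellsA κ Φ t p D g f).s 0 : ℕ) : ℤ) ∧ 14 * (KS0.R'0 κ Φ t p D mk : ℤ) + 27 ≤ (((fcellsA κ Φ t p D g f).s 1 : ℕ) : ℤ) :=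
  KS.sA_ge_of_floor' κ Φ t p D g f hN hκ hMR0

/-- **The (ζ′) stride unit of the transverse axis `J := oth I` vs the (S0) kit radius** at `g := gT`: `r_J = 40·Kq·u_JA`, `6·R'0 + 11 ≤ u_JA` (from the box
floor `4·K·(R'0+2) ≤ M_L (gT mk gx)`), `40·u_JA ≤ r_J` — the R′0 successor of `uA_oth_facts`. [folklore] -/
theorem uA_oth_factsR0 (κ : Consts) {V : Type} [DecidableEq V] [Countable V] {G : SimpleGraph V} [G.LocallyFinite] (Φ : PlanarSkeletonFrm G) (t : V) (p : unitInterval) (D : Skelφ.StepI.DataNS V) (f : ℕ) (mk : ℕ) (gx : Neg.FSlot) (hN : EqNumL κ Φ t p D (KS.gT mk gx κ Φ t p D) f) (hκ : (hL κ Φ t p D (KS.gT mk gx κ Φ t p D) f).natAbs ≤ 10 * nL κ Φ t p D (KS.gT mk gx κ Φ t p D) f)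
    (hMR0 : 4 * Neg.K κ * (KS0.R'0 κ Φ t p D mk + 2) ≤ ML κ Φ t p D (KS.gT mk gx κ Φ t p D)) (I : Fin 2) :
    ((fcellsA κ Φ t p D (KS.gT mk gx κ Φ t p D) f).r (oth I) : ℤ) =
        40 * (Neg.Kq κ : ℤ) * (if oth I = 0 then KS.u₀A κ Φ t p D (KS.gT mk gx κ Φ t p D) f else KS.u₁A κ Φ t p D (KS.gT mk gx κ Φ t p D) f) ∧
      6 * (KS0.R'0 κ Φ t p D mk : ℤ) + 11 ≤ (if oth I = 0 then KS.u₀A κ Φ t p D (KS.gT mk gx κ Φ t p D) f else KS.u₁A κ Φ t p D (KS.gT mk gx κ Φ t p D) f) ∧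
      40 * (if oth I = 0 then KS.u₀A κ Φ t p D (KS.gT mk gx κ Φ t p D) f else KS.u₁A κ Φ t p D (KS.gT mk gx κ Φ t p D) f) ≤
        ((fcellsA κ Φ t p D (KS.gT mk gx κ Φ t p D) f).r (oth I) : ℤ) := by
  obtain ⟨hr, -, hru⟩ := uA_oth_facts κ Φ t p D f mk gx hN hκ I
  obtain ⟨g0, g1⟩ := cells_geR0A κ Φ t p D (KS.gT mk gx κ Φ t p D) f mk hN hκ hMR0
  have hR : (0 : ℤ) ≤ (KS0.R'0 κ Φ t p D mk : ℤ) := Nat.cast_nonneg _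
  refine ⟨hr, ?_, hru⟩
  obtain rfl | rfl : I = 0 ∨ I = 1 := by fin_cases I <;> simp
  · rw [show oth (0 : Fin 2) = 1 from rfl]
    simp only [show ((1 : Fin 2) = 0) = False from propext ⟨fun h => absurd h (by decide), False.elim⟩, if_false]
    unfold KS.u₁A; linarith
  · rw [show oth (1 : Fin 2) = 0 from rfl]
    simp only [if_true]
    unfold KS.u₀A; linarith

end FloorsR0

/-! ## §1 The contact band's habitat floors at `Rl ≤ R′0` -/

section Band

/-- **THE TWO HABITAT FLOORS OF THE CONTACT BAND AT THE (S0) KIT RADIUS** at `g := gT`, every `Rl ≤ R'0`, both axes, under the stride floor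
`huR0 : 6·R'0 + 11 ≤ u_JA` (J19 floor-as-hypothesis; `uA_oth_factsR0` serves it from the box floor): `kFF₂ + 6·u_JA + 9 ≤ 5·r_J` and
`2·kFF₂ + 2·u_JA + 7 ≤ 5·r_J` — the R′0 successor of `hkE_RA`. [cite: KozmaNitzan2024, §4 Lemma 12 (pp. 23–25)] -/
theorem hkE_R0 (κ : Consts) {V : Type} [DecidableEq V] [Countable V] {G : SimpleGraph V} [G.LocallyFinite] (Φ : PlanarSkeletonFrm G) (t : V) (p : unitInterval) (D : Skelφ.StepI.DataNS V) (f : ℕ) (mk : ℕ) (gx : Neg.FSlot) (hN : EqNumL κ Φ t p D (KS.gT mk gx κ Φ t p D) f) (hκ : (hL κ Φ t p D (KS.gT mk gx κ Φ t p D) f).natAbs ≤ 10 * nL κ Φ t p D (KS.gT mk gx κ Φ t p D) f)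
    {Rl : ℕ} (hRl : Rl ≤ KS0.R'0 κ Φ t p D mk) (I : Fin 2)
    (huR0 : 6 * (KS0.R'0 κ Φ t p D mk : ℤ) + 11 ≤ (if oth I = 0 then KS.u₀A κ Φ t p D (KS.gT mk gx κ Φ t p D) f else KS.u₁A κ Φ t p D (KS.gT mk gx κ Φ t p D) f)) :
    (prFA κ Φ t p D (KS.gT mk gx κ Φ t p D) f).kFF₂ (fcellsA κ Φ t p D (KS.gT mk gx κ Φ t p D) f) Rl I +
          6 * (if oth I = 0 then KS.u₀A κ Φ t p D (KS.gT mk gx κ Φ t p D) f else KS.u₁A κ Φ t p D (KS.gT mk gx κ Φ t p D) f) + 9 ≤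
        5 * ((fcellsA κ Φ t p D (KS.gT mk gx κ Φ t p D) f).r (oth I) : ℤ) ∧
      2 * (prFA κ Φ t p D (KS.gT mk gx κ Φ t p D) f).kFF₂ (fcellsA κ Φ t p D (KS.gT mk gx κ Φ t p D) f) Rl I +
          2 * (if oth I = 0 then KS.u₀A κ Φ t p D (KS.gT mk gx κ Φ t p D) f else KS.u₁A κ Φ t p D (KS.gT mk gx κ Φ t p D) f) + 7 ≤
        5 * ((fcellsA κ Φ t p D (KS.gT mk gx κ Φ t p D) f).r (oth I) : ℤ) := by
  have hq := kFF₂_le_linA κ Φ t p D f mk gx hN hκ Rl I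
  obtain ⟨-, -, hru⟩ := uA_oth_facts κ Φ t p D f mk gx hN hκ I
  have hu := huR0
  have hRl' : (Rl : ℤ) ≤ KS0.R'0 κ Φ t p D mk := by exact_mod_cast hRl
  have hR0 : (0 : ℤ) ≤ (Rl : ℤ) := Nat.cast_nonneg _
  set q := (prFA κ Φ t p D (KS.gT mk gx κ Φ t p D) f).kFF₂ (fcellsA κ Φ t p D (KS.gT mk gx κ Φ t p D) f) Rl I
  set u := (if oth I = 0 then KS.u₀A κ Φ t p D (KS.gT mk gx κ Φ t p D) f else KS.u₁A κ Φ t p D (KS.gT mk gx κ Φ t p D) f)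
  set r := ((fcellsA κ Φ t p D (KS.gT mk gx κ Φ t p D) f).r (oth I) : ℤ)
  constructor <;> linarith

end Band

end NegB

end PlanarSkeletonFrm

end Summit.CriticalPhenomena.PercolationContinuityZ3.Theorems.Transplant

end
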